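import Literature.NumberTheory.Sieve.VinogradovExpSumTools
import Literature.NumberTheory.LFunctions.MertensBoundRH
import HarnessLib

/-!
# RH-EQUIVALENT · Verjovsky's local Fourier-moment criterion: RH ⟺ high local moments of the normalized Möbius Fourier polynomial on arcs of length `≍ 1/N` grow subpolynomially — PROVED; nothing here bears on the truth of RH

A. Verjovsky, *How Random Is the Möbius Function? Smoothing, Probability, and the Riemann
Hypothesis*, arXiv:2607.25002 (v2, 2026), §4 Thm. 4.1 with §9 (Lemma 9.1, Prop. 9.2, Cor. 9.3)
and §10 (proof). With

  `S_N(t) = Σ_{n ≤ N} μ(n) e(nt)`, `P_N = S_N/√N` (3),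
  `M_{q,c}(N) = ((N/2c) ∫_{−c/N}^{c/N} |P_N(t)|^q dt)^{1/q}` (4),

**Thm. 4.1** (fix `c > 0`): (i) RH ⟺ (ii) for every `η > 0` and every finite `q ≥ 1`,
`M_{q,c}(N) = O_{η,q,c}(N^η)` ⟺ (iii) for every `η > 0` there is an unbounded set `Q_η ⊆ [1,∞)`
with `M_{q,c}(N) = O(N^η)` for `q ∈ Q_η`.

Everything is PROVED, following the printed proof:

* §1 definitions: `moebiusFourierPoly` (`S_N`, = the tree's `afExpSum` with Möbius coefficients),
  `localPowerMean S q r = (2r)^{−1} ∫_{−r}^{r} |S|^q` (`= B_q(S;r)^q`, (8)), `localLqMean` (`B_q`),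
  `moebiusLocalMoment q c N` (`M_{q,c}(N)`, (4)); `S_N(0) = M(N)`.
* §2 **Lemma 9.1** (persistence, RH-FREE): `|S_N(t) − S_N(0)| ≤ 2π|t| Σ_{n≤N} n ≤ 2πN²|t|` for
  coefficients `|a_n| ≤ 1`, hence `|S_N(t)| ≥ A/2` for `|t| ≤ A/(4πN²)`, `A = |S_N(0)|` (the paper's
  `L = πN(N+1)` is replaced by the majorant `2πN²` it uses itself: "`1 + N^{−1} ≤ 2`").
* §3 **Prop. 9.2** (local moment-to-point-value inequality, RH-FREE), in the root-free form
  `A^q ≤ 2^q B` or `A^{q+1} ≤ 2^{q+2} π N² r B`, `B = B_q(S_N;r)^q`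
  (`Verjovsky2026_prop_9_2`), and **Cor. 9.3** for the Möbius polynomial at `r = c/N` via the
  identity (10) `B_q(S_N; c/N)^q = N^{q/2} M_{q,c}(N)^q`.
* §4 "(i) ⟹ (ii)": Abel summation `S_N(t) = M(N)e(Nt) + Σ_{n<N} M(n)(e(nt) − e((n+1)t))` (the
  series form of (12)), Littlewood's `M(x) ≪ x^{1/2+δ}` under RH (tree
  `mertensFunction_isBigO_of_riemannHypothesis`), `|S_N(t)| ≪ N^{1/2+δ}(1 + 2πN|t|)`, so
  `|P_N| ≪ N^δ` on the arc and `M_{q,c}(N) ≪ N^δ`.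
* §5 "(iii) ⟹ (i)": choose `η < ε/3`, then `q ∈ Q_η` with `1/(2(q+1)) < ε/3`; Cor. 9.3 gives
  `M(N) = O(N^{1/2+ε})`, and Littlewood's converse (tree `riemannHypothesis_of_mertensFunction_isBigO`)
  gives RH. Assembly: `Verjovsky2026_thm_4_1` ((i) ⟺ (ii)), `Verjovsky2026_thm_4_1_iii` ((i) ⟺ (iii)).

Labels: RH-EQUIVALENT literature (proved `↔`; neither side asserted); §§2–3 are RH-FREE
inequalities about trigonometric polynomials. Definitions only for the printed objects; no named
facts. Nothing here bears on the truth of RH.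

## References

* A. Verjovsky, arXiv:2607.25002 (2026), §1 (3)–(4), §4 Thm. 4.1 / Remark 4.2, §9 Lemma 9.1,
  (8), Prop. 9.2 (9), (10), Cor. 9.3 (11), Remark 9.4, §10 proof of Thm. 4.1 (12). [Verjovsky2026]
* E. C. Titchmarsh, *The Theory of the Riemann Zeta-Function*, 2nd ed. (1986), Thm. 14.25
  (Littlewood's criterion, both directions in the tree). [Titchmarsh1986]
-/

noncomputable section

open Filter Asymptotics MeasureTheory Set Real Finset
open scoped Topology ArithmeticFunction.Moebius FourierTransform
open Literature.NumberTheory.Sieve.Vinogradov (afExpSum)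

namespace Literature.NumberTheory.LFunctions

/-! ## §1 The objects (3), (4), (8) -/

/-- The Möbius Fourier polynomial `S_N(t) = Σ_{n ≤ N} μ(n) e(nt)` ((3); the tree's `afExpSum` with
Möbius coefficients). [cite: Verjovsky2026, §1 eq. (3)] -/
def moebiusFourierPoly (N : ℕ) (t : ℝ) : ℂ :=
  afExpSum (fun n ↦ ((μ n : ℤ) : ℝ)) N t

/-- The local `q`-th power mean of `S` on the arc `[−r, r]`: `(2r)^{−1} ∫_{−r}^{r} |S(t)|^q dt`
(the `q`-th power of the paper's `B_q(S; r)`, (8)). [cite: Verjovsky2026, §9 eq. (8)] -/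
def localPowerMean (S : ℝ → ℂ) (q r : ℝ) : ℝ :=
  (2 * r)⁻¹ * ∫ t in (-r)..r, ‖S t‖ ^ q

/-- The normalized local `L^q`-mean `B_q(S; r) = ((2r)^{−1} ∫_{−r}^{r} |S(t)|^q dt)^{1/q}` (8).
[cite: Verjovsky2026, §9 eq. (8)] -/
def localLqMean (S : ℝ → ℂ) (q r : ℝ) : ℝ :=
  localPowerMean S q r ^ (1 / q)

/-- The local moment `M_{q,c}(N) = ((N/2c) ∫_{−c/N}^{c/N} |P_N(t)|^q dt)^{1/q}`, `P_N = S_N/√N`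
((4); note `N/(2c) = (2 · c/N)^{−1}`). [cite: Verjovsky2026, §1 eq. (4)] -/
def moebiusLocalMoment (q c : ℝ) (N : ℕ) : ℝ :=
  localLqMean (fun t ↦ moebiusFourierPoly N t / ((Real.sqrt N : ℝ) : ℂ)) q (c / N)

namespace MoebiusFourier

/-- Unfolding of `S_N`. [cite: Verjovsky2026, §1 eq. (3)] -/
theorem moebiusFourierPoly_eq (N : ℕ) (t : ℝ) :
    moebiusFourierPoly N t = ∑ n ∈ Icc 1 N, ((((μ n : ℤ) : ℝ) : ℂ)) * (𝐞 ((n : ℝ) * t) : ℂ) := rfl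

/-- `P_N(0) = M(N)/√N`, i.e. `S_N(0) = M(N)`. [cite: Verjovsky2026, §1 ("P_N(0) = M(N)/√N")] -/
theorem moebiusFourierPoly_zero (N : ℕ) :
    moebiusFourierPoly N 0 = (mertensFunction (N : ℝ) : ℂ) := by
  rw [moebiusFourierPoly_eq, MertensDictionary.mertensFunction_natCast]
  push_cast
  rw [show Finset.Icc 1 N = Finset.Ioc 0 N from rfl]
  refine Finset.sum_congr rfl fun n _ ↦ ?_
  simp

/-- `e((n+1)t) − e(nt) = e(nt)(e(t) − 1)`, so `|e(nt) − e((n+1)t)| ≤ 2π|t|`. [folklore] -/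
private theorem norm_fourierChar_sub_succ_le (n : ℕ) (t : ℝ) :
    ‖(𝐞 ((n : ℝ) * t) : ℂ) - 𝐞 (((n : ℝ) + 1) * t)‖ ≤ 2 * π * |t| := by
  have h1 : ((n : ℝ) + 1) * t = (n : ℝ) * t + t := by ring
  rw [h1, AddChar.map_add_eq_mul, Circle.coe_mul, ← mul_one_sub, norm_mul,
    Circle.norm_coe, one_mul, norm_sub_rev, Real.fourierChar_apply, mul_comm _ Complex.I]
  refine Real.norm_exp_I_mul_ofReal_sub_one_le.trans (le_of_eq ?_)
  rw [Real.norm_eq_abs, abs_mul, abs_of_pos Real.two_pi_pos]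

/-- `|e(nt) − 1| ≤ 2π n |t|`. [folklore] -/
private theorem norm_fourierChar_natMul_sub_one_le (n : ℕ) (t : ℝ) :
    ‖(𝐞 ((n : ℝ) * t) : ℂ) - 1‖ ≤ 2 * π * n * |t| := by
  rw [Real.fourierChar_apply, mul_comm _ Complex.I]
  refine Real.norm_exp_I_mul_ofReal_sub_one_le.trans (le_of_eq ?_)
  rw [Real.norm_eq_abs, show 2 * π * ((n : ℝ) * t) = (2 * π * n) * t by ring, abs_mul,
    abs_of_nonneg (by positivity : (0 : ℝ) ≤ 2 * π * n)]

/-- `S_N` is continuous in `t`. [cite: Verjovsky2026, §1 eq. (3) (a trigonometric polynomial)] -/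
theorem continuous_afExpSum (a : ℕ → ℝ) (N : ℕ) : Continuous (afExpSum a N) := by
  unfold afExpSum
  simp only [Real.fourierChar_apply]
  fun_prop

/-! ## §2 Lemma 9.1: persistence of a large central value -/

/-- **Lemma 9.1 (first assertion, majorant form)**: for `S_N(t) = Σ_{n≤N} a_n e(nt)` with
`|a_n| ≤ 1`, `|S_N(t) − S_N(0)| ≤ 2π N² |t|` (the paper's mean-value estimate with
`L = πN(N+1) ≤ 2πN²`). RH-FREE. [cite: Verjovsky2026, Lemma 9.1 (|S_N(t) − S_N(0)| ≤ πN(N+1)|t|)] -/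
theorem norm_afExpSum_sub_zero_le {a : ℕ → ℝ} (ha : ∀ n, |a n| ≤ 1) (N : ℕ) (t : ℝ) :
    ‖afExpSum a N t - afExpSum a N 0‖ ≤ 2 * π * (N : ℝ) ^ 2 * |t| := by
  unfold afExpSum
  rw [← Finset.sum_sub_distrib]
  have hterm : ∀ n ∈ Finset.Icc 1 N, ‖(a n : ℂ) * (𝐞 ((n : ℝ) * t) : ℂ) - (a n : ℂ) * (𝐞 ((n : ℝ) * 0) : ℂ)‖
      ≤ 2 * π * N * |t| := by
    intro n hn
    have hnN : (n : ℝ) ≤ N := by exact_mod_cast (Finset.mem_Icc.1 hn).2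
    rw [mul_zero, AddChar.map_zero_eq_one, Circle.coe_one, ← mul_sub, norm_mul, Complex.norm_real,
      Real.norm_eq_abs]
    calc |a n| * ‖(𝐞 ((n : ℝ) * t) : ℂ) - 1‖ ≤ 1 * (2 * π * n * |t|) :=
          mul_le_mul (ha n) (norm_fourierChar_natMul_sub_one_le n t) (norm_nonneg _) zero_le_one
      _ ≤ 2 * π * N * |t| := by
          rw [one_mul]; gcongr
  calc ‖∑ n ∈ Icc 1 N, ((a n : ℂ) * (𝐞 ((n : ℝ) * t) : ℂ) - (a n : ℂ) * (𝐞 ((n : ℝ) * 0) : ℂ))‖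
      ≤ ∑ n ∈ Icc 1 N, ‖(a n : ℂ) * (𝐞 ((n : ℝ) * t) : ℂ) - (a n : ℂ) * (𝐞 ((n : ℝ) * 0) : ℂ)‖ :=
        norm_sum_le _ _
    _ ≤ ∑ n ∈ Icc 1 N, 2 * π * N * |t| := Finset.sum_le_sum hterm
    _ = 2 * π * (N : ℝ) ^ 2 * |t| := by
        rw [Finset.sum_const, Nat.card_Icc, nsmul_eq_mul]
        push_cast
        ring

/-- **Lemma 9.1 (second assertion)**: with `A = |S_N(0)|`, `|S_N(t)| ≥ A/2` whenever
`|t| ≤ A/(4πN²)` (`= A/(2L)` for `L = 2πN²`). RH-FREE. [cite: Verjovsky2026, Lemma 9.1 (|S_N(t)| ≥ A/2 for |t| ≤ A/(2πN(N+1)))] -/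
theorem half_norm_le_norm_afExpSum {a : ℕ → ℝ} (ha : ∀ n, |a n| ≤ 1) {N : ℕ} (hN : 1 ≤ N) {t : ℝ}
    (ht : |t| ≤ ‖afExpSum a N 0‖ / (4 * π * (N : ℝ) ^ 2)) :
    ‖afExpSum a N 0‖ / 2 ≤ ‖afExpSum a N t‖ := by
  have hN' : (0 : ℝ) < 4 * π * (N : ℝ) ^ 2 := by
    have : (1 : ℝ) ≤ N := by exact_mod_cast hN
    positivity
  have h1 := norm_afExpSum_sub_zero_le ha N t
  have h2 : 2 * π * (N : ℝ) ^ 2 * |t| ≤ ‖afExpSum a N 0‖ / 2 := by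
    calc 2 * π * (N : ℝ) ^ 2 * |t| ≤ 2 * π * (N : ℝ) ^ 2 * (‖afExpSum a N 0‖ / (4 * π * (N : ℝ) ^ 2)) :=
          by gcongr
      _ = ‖afExpSum a N 0‖ / 2 := by field_simp; ring
  have h3 : ‖afExpSum a N 0‖ - ‖afExpSum a N t‖ ≤ ‖afExpSum a N t - afExpSum a N 0‖ := by
    rw [norm_sub_rev]; exact norm_sub_norm_le _ _
  linarith

/-! ## §3 Prop. 9.2 (local moment-to-point-value) and Cor. 9.3 -/

/-- `t ↦ |S_N(t)|^q` is continuous (`q > 0`), hence interval integrable. [folklore] -/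
private theorem intervalIntegrable_norm_afExpSum_rpow (a : ℕ → ℝ) (N : ℕ) {q : ℝ} (hq : 0 < q)
    (x y : ℝ) : IntervalIntegrable (fun t ↦ ‖afExpSum a N t‖ ^ q) volume x y :=
  ((continuous_afExpSum a N).norm.rpow_const fun _ ↦ Or.inr hq.le).intervalIntegrable _ _

/-- The local power mean is nonnegative (`r ≥ 0`). [cite: Verjovsky2026, §9 eq. (8)] -/
theorem localPowerMean_nonneg (S : ℝ → ℂ) (q : ℝ) {r : ℝ} (hr : 0 ≤ r) :
    0 ≤ localPowerMean S q r := by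
  unfold localPowerMean
  refine mul_nonneg (by positivity) ?_
  exact intervalIntegral.integral_nonneg_of_forall (by linarith) fun t ↦ by positivity

/-- Sup bound ⟹ mean bound: if `|S| ≤ B` on `[−r, r]` (`r > 0`, `q > 0`) then
`(2r)^{−1}∫_{−r}^{r}|S|^q ≤ B^q`. [cite: Verjovsky2026, §10 proof of Thm. 4.1 ("|P_N(t)| ≪ N^δ for |t| ≤ c/N, therefore M_{q,c}(N) ≪ N^δ")] -/
theorem localPowerMean_le_of_norm_le {S : ℝ → ℂ} {q r B : ℝ} (hr : 0 < r) (hq : 0 < q)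
    (h : ∀ t ∈ Set.Icc (-r) r, ‖S t‖ ≤ B) : localPowerMean S q r ≤ B ^ q := by
  unfold localPowerMean
  have hI : ‖∫ t in (-r)..r, ‖S t‖ ^ q‖ ≤ B ^ q * |r - -r| := by
    refine intervalIntegral.norm_integral_le_of_norm_le_const fun t ht ↦ ?_
    rw [Set.uIoc_of_le (by linarith)] at ht
    rw [Real.norm_eq_abs, abs_of_nonneg (by positivity)]
    exact rpow_le_rpow (norm_nonneg _) (h t (Set.Ioc_subset_Icc_self ht)) hq.le
  rw [show r - -r = 2 * r by ring, abs_of_pos (by linarith)] at hI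
  calc (2 * r)⁻¹ * ∫ t in (-r)..r, ‖S t‖ ^ q ≤ (2 * r)⁻¹ * (B ^ q * (2 * r)) := by
        gcongr
        exact (Real.le_norm_self _).trans hI
    _ = B ^ q := by field_simp

/-- **Prop. 9.2, root-free form** (RH-FREE): for `S_N(t) = Σ_{n≤N} a_n e(nt)` with `|a_n| ≤ 1`,
`N ≥ 1`, `q > 0`, `r > 0`, `A = |S_N(0)|` and `B = (2r)^{−1}∫_{−r}^{r}|S_N|^q`: either `A^q ≤ 2^q B`
(case `A/(2L) ≥ r`: `|S_N| ≥ A/2` on the whole arc) or `A^{q+1} ≤ 2^{q+2} π N² r B` (case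
`A/(2L) < r`: `|S_N| ≥ A/2` on an arc of length `A/L`). [cite: Verjovsky2026, Prop. 9.2 (proof, both cases)] -/
theorem Verjovsky2026_prop_9_2 {a : ℕ → ℝ} (ha : ∀ n, |a n| ≤ 1) {N : ℕ} (hN : 1 ≤ N)
    {q r : ℝ} (hq : 0 < q) (hr : 0 < r) :
    ‖afExpSum a N 0‖ ^ q ≤ 2 ^ q * localPowerMean (afExpSum a N) q r ∨
      ‖afExpSum a N 0‖ ^ (q + 1) ≤
        2 ^ (q + 2) * π * (N : ℝ) ^ 2 * r * localPowerMean (afExpSum a N) q r := by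
  set A : ℝ := ‖afExpSum a N 0‖ with hA
  set B : ℝ := localPowerMean (afExpSum a N) q r with hB
  have hA0 : 0 ≤ A := norm_nonneg _
  have hB0 : 0 ≤ B := localPowerMean_nonneg _ _ hr.le
  have hNpos : (0 : ℝ) < 4 * π * (N : ℝ) ^ 2 := by
    have : (1 : ℝ) ≤ N := by exact_mod_cast hN
    positivity
  rcases hA0.eq_or_lt with hA00 | hApos
  · left
    rw [← hA00, Real.zero_rpow hq.ne']
    positivity
  -- `ρ = min r (A/(4πN²))`; on `[−ρ, ρ]`, `|S| ≥ A/2`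
  set ρ : ℝ := min r (A / (4 * π * (N : ℝ) ^ 2)) with hρ
  have hρpos : 0 < ρ := lt_min hr (div_pos hApos hNpos)
  have hρr : ρ ≤ r := min_le_left _ _
  have hρA : ρ ≤ A / (4 * π * (N : ℝ) ^ 2) := min_le_right _ _
  have hlow : ∀ t ∈ Set.Icc (-ρ) ρ, (A / 2) ^ q ≤ ‖afExpSum a N t‖ ^ q := by
    intro t ht
    have ht' : |t| ≤ A / (4 * π * (N : ℝ) ^ 2) := (abs_le.2 ⟨ht.1, ht.2⟩).trans hρA
    exact rpow_le_rpow (by positivity) (half_norm_le_norm_afExpSum ha hN ht') hq.le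
  -- `∫_{−r}^{r} |S|^q ≥ ∫_{−ρ}^{ρ} |S|^q ≥ 2ρ (A/2)^q`
  have hint1 : ∫ t in (-ρ)..ρ, (A / 2) ^ q ≤ ∫ t in (-ρ)..ρ, ‖afExpSum a N t‖ ^ q :=
    intervalIntegral.integral_mono_on (by linarith) intervalIntegrable_const
      (intervalIntegrable_norm_afExpSum_rpow a N hq _ _) hlow
  rw [intervalIntegral.integral_const, smul_eq_mul, show ρ - -ρ = 2 * ρ by ring] at hint1
  have hint2 : ∫ t in (-ρ)..ρ, ‖afExpSum a N t‖ ^ q ≤ ∫ t in (-r)..r, ‖afExpSum a N t‖ ^ q :=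
    intervalIntegral.integral_mono_interval (by linarith) (by linarith) hρr
      (ae_of_all _ fun t ↦ by positivity) (intervalIntegrable_norm_afExpSum_rpow a N hq _ _)
  have hBge : (2 * r)⁻¹ * (2 * ρ * (A / 2) ^ q) ≤ B := by
    rw [hB, localPowerMean]
    gcongr
    exact hint1.trans hint2
  have hAq : (A / 2) ^ q = A ^ q / 2 ^ q := div_rpow hA0 zero_le_two q
  have h2q : (0 : ℝ) < 2 ^ q := rpow_pos_of_pos two_pos q
  rcases le_or_gt r (A / (4 * π * (N : ℝ) ^ 2)) with hcase | hcase
  · -- `ρ = r`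
    left
    have hρeq : ρ = r := min_eq_left hcase
    rw [hρeq, hAq] at hBge
    have hr2 : (2 * r) ≠ 0 := by positivity
    have : A ^ q / 2 ^ q ≤ B := by rwa [inv_mul_cancel_left₀ hr2] at hBge
    rw [div_le_iff₀ h2q] at this
    linarith
  · -- `ρ = A/(4πN²) < r`
    right
    have hρeq : ρ = A / (4 * π * (N : ℝ) ^ 2) := min_eq_right hcase.le
    rw [hρeq, hAq] at hBge
    -- `hBge : (2r)⁻¹ * (2 (A/(4πN²)) (A^q/2^q)) ≤ B`, i.e. `A^{q+1} ≤ 2^{q+2} π N² r B`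
    have hr2 : (0 : ℝ) < 2 * r := by linarith
    have key : A ^ q * A ≤ 2 ^ q * 4 * π * (N : ℝ) ^ 2 * r * B := by
      have h := mul_le_mul_of_nonneg_left hBge (le_of_lt (mul_pos hr2 (mul_pos h2q hNpos)))
      have lhs : 2 * r * (2 ^ q * (4 * π * (N : ℝ) ^ 2)) *
          ((2 * r)⁻¹ * (2 * (A / (4 * π * (N : ℝ) ^ 2)) * (A ^ q / 2 ^ q))) = 2 * (A ^ q * A) := by
        field_simp
      rw [lhs] at h
      nlinarith [h]
    rw [rpow_add_one hApos.ne', show q + 2 = q + (2 : ℝ) by ring, rpow_add two_pos, rpow_two]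
    nlinarith [key]

/-- The scaling identity (10) in power form: `B_q(S_N; r)^q = N^{q/2} · ((2r)^{−1}∫_{−r}^{r}|P_N|^q)`
for `P_N = S_N/√N`, `N ≥ 1`, `q > 0`. [cite: Verjovsky2026, §9 eq. (10)] -/
theorem localPowerMean_div_sqrt {N : ℕ} (hN : 1 ≤ N) (q r : ℝ) :
    localPowerMean (fun t ↦ moebiusFourierPoly N t / ((Real.sqrt N : ℝ) : ℂ)) q r =
      (N : ℝ) ^ (-(q / 2)) * localPowerMean (moebiusFourierPoly N) q r := by
  have hN0 : (0 : ℝ) < N := by exact_mod_cast hN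
  have hsq : 0 < Real.sqrt N := Real.sqrt_pos.2 hN0
  unfold localPowerMean
  have hpt : ∀ t : ℝ, ‖moebiusFourierPoly N t / ((Real.sqrt N : ℝ) : ℂ)‖ ^ q =
      (N : ℝ) ^ (-(q / 2)) * ‖moebiusFourierPoly N t‖ ^ q := by
    intro t
    rw [norm_div, Complex.norm_real, Real.norm_eq_abs, abs_of_pos hsq,
      div_rpow (norm_nonneg _) hsq.le, Real.sqrt_eq_rpow, ← rpow_mul hN0.le, div_eq_mul_inv,
      ← rpow_neg hN0.le, mul_comm]
    congr 2
    ring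
  rw [show (fun t : ℝ ↦ ‖moebiusFourierPoly N t / ((Real.sqrt N : ℝ) : ℂ)‖ ^ q) =
      fun t : ℝ ↦ (N : ℝ) ^ (-(q / 2)) * ‖moebiusFourierPoly N t‖ ^ q from funext hpt,
    intervalIntegral.integral_const_mul]
  ring

/-- `M_{q,c}(N)^q = (2r)^{−1}∫_{−r}^{r}|P_N|^q` at `r = c/N` (`q > 0`, `c ≥ 0`). [cite: Verjovsky2026, §1 eq. (4)] -/
theorem moebiusLocalMoment_rpow {q c : ℝ} (hq : 0 < q) (hc : 0 ≤ c) (N : ℕ) :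
    moebiusLocalMoment q c N ^ q =
      localPowerMean (fun t ↦ moebiusFourierPoly N t / ((Real.sqrt N : ℝ) : ℂ)) q (c / N) := by
  unfold moebiusLocalMoment localLqMean
  rw [one_div, rpow_inv_rpow (localPowerMean_nonneg _ _ (by positivity)) hq.ne']

/-- `M_{q,c}(N) ≥ 0`. [cite: Verjovsky2026, §1 eq. (4)] -/
theorem moebiusLocalMoment_nonneg {q c : ℝ} (hc : 0 ≤ c) (N : ℕ) :
    0 ≤ moebiusLocalMoment q c N := by
  unfold moebiusLocalMoment localLqMean
  exact rpow_nonneg (localPowerMean_nonneg _ _ (by positivity)) _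

/-- Root extraction: `A^p ≤ Y`, `A ≥ 0`, `p > 0` ⟹ `A ≤ Y^{1/p}`. [folklore] -/
private theorem le_rpow_one_div_of_rpow_le {A Y p : ℝ} (hA : 0 ≤ A) (hp : 0 < p) (h : A ^ p ≤ Y) :
    A ≤ Y ^ (1 / p) := by
  have hY : 0 ≤ Y := (rpow_nonneg hA p).trans h
  calc A = (A ^ p) ^ (1 / p) := by
        rw [← rpow_mul hA, mul_one_div_cancel hp.ne', rpow_one]
    _ ≤ Y ^ (1 / p) := rpow_le_rpow (rpow_nonneg hA p) h (by positivity)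

/-- **Cor. 9.3 (quantitative form used in §10)**: for `N ≥ 1`, `q > 0`, `c > 0`, with
`M = M_{q,c}(N)`: `|M(N)| ≤ 2 √N M` or `|M(N)| ≤ (2^{q+2}πc)^{1/(q+1)} N^{(1+q/2)/(q+1)} M^{q/(q+1)}`
(the two terms of (11); the printed statement takes their maximum with a common constant).
RH-FREE. [cite: Verjovsky2026, Cor. 9.3 eq. (11) (proof: Prop. 9.2 at r = c/N and identity (10))] -/
theorem Verjovsky2026_cor_9_3 {N : ℕ} (hN : 1 ≤ N) {q c : ℝ} (hq : 0 < q) (hc : 0 < c) :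
    |(mertensFunction (N : ℝ) : ℝ)| ≤ 2 * Real.sqrt N * moebiusLocalMoment q c N ∨
      |(mertensFunction (N : ℝ) : ℝ)| ≤
        (2 ^ (q + 2) * π * c) ^ (1 / (q + 1)) * (N : ℝ) ^ ((1 + q / 2) / (q + 1)) *
          moebiusLocalMoment q c N ^ (q / (q + 1)) := by
  have hN0 : (0 : ℝ) < N := by exact_mod_cast hN
  have hA : ‖afExpSum (fun n ↦ ((μ n : ℤ) : ℝ)) N 0‖ = |(mertensFunction (N : ℝ) : ℝ)| := by
    rw [show afExpSum (fun n ↦ ((μ n : ℤ) : ℝ)) N 0 = moebiusFourierPoly N 0 from rfl,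
      moebiusFourierPoly_zero, ← Complex.ofReal_intCast, Complex.norm_real, Real.norm_eq_abs]
  have hμ : ∀ n, |((μ n : ℤ) : ℝ)| ≤ 1 := fun n ↦ by
    exact_mod_cast ArithmeticFunction.abs_moebius_le_one
  set M : ℝ := moebiusLocalMoment q c N with hM
  have hM0 : 0 ≤ M := moebiusLocalMoment_nonneg hc.le N
  have hA0 : 0 ≤ |(mertensFunction (N : ℝ) : ℝ)| := abs_nonneg _
  -- `B_q(S_N; c/N)^q = N^{q/2} M^q`
  have hB : localPowerMean (afExpSum (fun n ↦ ((μ n : ℤ) : ℝ)) N) q (c / N) =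
      (N : ℝ) ^ (q / 2) * M ^ q := by
    rw [show afExpSum (fun n ↦ ((μ n : ℤ) : ℝ)) N = moebiusFourierPoly N from rfl, hM,
      moebiusLocalMoment_rpow hq hc.le, localPowerMean_div_sqrt hN, ← mul_assoc,
      ← rpow_add hN0, show q / 2 + -(q / 2) = 0 by ring, rpow_zero, one_mul]
  rcases Verjovsky2026_prop_9_2 hμ hN hq (div_pos hc hN0) with h1 | h2
  · left
    rw [hA, hB] at h1
    -- `A^q ≤ 2^q N^{q/2} M^q = (2 √N M)^q`
    have h1' : |(mertensFunction (N : ℝ) : ℝ)| ^ q ≤ (2 * Real.sqrt N * M) ^ q := by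
      rw [mul_rpow (by positivity) hM0, mul_rpow zero_le_two (Real.sqrt_nonneg _),
        Real.sqrt_eq_rpow, ← rpow_mul hN0.le, show 1 / 2 * q = q / 2 by ring]
      linarith
    have := le_rpow_one_div_of_rpow_le hA0 hq h1'
    rwa [← rpow_mul (by positivity), mul_one_div_cancel hq.ne', rpow_one] at this
  · right
    rw [hA, hB] at h2
    have hq1 : 0 < q + 1 := by linarith
    -- `A^{q+1} ≤ 2^{q+2} π N² (c/N) N^{q/2} M^q = (2^{q+2}πc) N^{1+q/2} M^q`
    have h2' : |(mertensFunction (N : ℝ) : ℝ)| ^ (q + 1) ≤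
        (2 ^ (q + 2) * π * c) * (N : ℝ) ^ (1 + q / 2) * M ^ q := by
      have hN2 : (N : ℝ) ^ 2 * (c / N) * ((N : ℝ) ^ (q / 2)) = c * (N : ℝ) ^ (1 + q / 2) := by
        rw [rpow_add hN0, rpow_one]
        field_simp
      calc |(mertensFunction (N : ℝ) : ℝ)| ^ (q + 1)
          ≤ 2 ^ (q + 2) * π * (N : ℝ) ^ 2 * (c / N) * ((N : ℝ) ^ (q / 2) * M ^ q) := h2
        _ = 2 ^ (q + 2) * π * ((N : ℝ) ^ 2 * (c / N) * (N : ℝ) ^ (q / 2)) * M ^ q := by ring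
        _ = (2 ^ (q + 2) * π * c) * (N : ℝ) ^ (1 + q / 2) * M ^ q := by rw [hN2]; ring
    have h3 := le_rpow_one_div_of_rpow_le hA0 hq1 h2'
    rw [mul_rpow (by positivity) (rpow_nonneg hM0 _), mul_rpow (by positivity) (by positivity),
      ← rpow_mul hN0.le, ← rpow_mul hM0] at h3
    convert h3 using 3 <;> ring

/-! ## §4 "(i) ⟹ (ii)": Abel summation and Littlewood's bound under RH -/

/-- **Abel summation (series form of (12))**: `S_N(t) = M(N) e(Nt) + Σ_{n<N} M(n)(e(nt) − e((n+1)t))`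
(`M(0) = 0`). [cite: Verjovsky2026, §10 proof of Thm. 4.1, eq. (12) (partial summation)] -/
theorem moebiusFourierPoly_eq_abel (N : ℕ) (t : ℝ) :
    moebiusFourierPoly N t =
      (mertensFunction (N : ℝ) : ℂ) * (𝐞 ((N : ℝ) * t) : ℂ) +
        ∑ n ∈ Finset.range N, (mertensFunction (n : ℝ) : ℂ) *
          ((𝐞 ((n : ℝ) * t) : ℂ) - 𝐞 (((n : ℝ) + 1) * t)) := by
  induction N with
  | zero => simp [moebiusFourierPoly_eq, MertensDictionary.mertensFunction_zero]
  | succ N ih =>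
    rw [moebiusFourierPoly_eq, Finset.sum_Icc_succ_top (by omega), ← moebiusFourierPoly_eq, ih,
      Finset.sum_range_succ, MertensDictionary.mertensFunction_succ]
    push_cast
    ring

/-- From `|M(n)| ≤ C n^a` (`n ≥ 1`; `C, a ≥ 0`): `|S_N(t)| ≤ C N^a (1 + 2πN|t|)` — the estimate
"`|S_N(t)| ≪_δ N^{1/2+δ}(1 + N|t|)`" of the proof. [cite: Verjovsky2026, §10 proof of Thm. 4.1 ("Consequently, |S_N(t)| ≪ N^{1/2+δ}(1 + N|t|)")] -/
theorem norm_moebiusFourierPoly_le {C a : ℝ} (hC : 0 ≤ C) (ha : 0 ≤ a)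
    (hM : ∀ n : ℕ, 1 ≤ n → |(mertensFunction (n : ℝ) : ℝ)| ≤ C * (n : ℝ) ^ a) (N : ℕ) (t : ℝ) :
    ‖moebiusFourierPoly N t‖ ≤ C * (N : ℝ) ^ a * (1 + 2 * π * N * |t|) := by
  have hMn : ∀ n : ℕ, n ≤ N → |(mertensFunction (n : ℝ) : ℝ)| ≤ C * (N : ℝ) ^ a := by
    intro n hn
    rcases Nat.eq_zero_or_pos n with rfl | hpos
    · simp only [Nat.cast_zero, MertensDictionary.mertensFunction_zero, Int.cast_zero, abs_zero]
      positivity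
    · exact (hM n hpos).trans (mul_le_mul_of_nonneg_left
        (rpow_le_rpow (Nat.cast_nonneg _) (by exact_mod_cast hn) ha) hC)
  rw [moebiusFourierPoly_eq_abel]
  refine (norm_add_le _ _).trans ?_
  have h1 : ‖(mertensFunction (N : ℝ) : ℂ) * (𝐞 ((N : ℝ) * t) : ℂ)‖ ≤ C * (N : ℝ) ^ a := by
    rw [norm_mul, Circle.norm_coe, mul_one, ← Complex.ofReal_intCast, Complex.norm_real,
      Real.norm_eq_abs]
    exact hMn N le_rfl
  have h2 : ‖∑ n ∈ Finset.range N, (mertensFunction (n : ℝ) : ℂ) *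
      ((𝐞 ((n : ℝ) * t) : ℂ) - 𝐞 (((n : ℝ) + 1) * t))‖ ≤
      ∑ n ∈ Finset.range N, C * (N : ℝ) ^ a * (2 * π * |t|) := by
    refine (norm_sum_le _ _).trans (Finset.sum_le_sum fun n hn ↦ ?_)
    rw [norm_mul, ← Complex.ofReal_intCast, Complex.norm_real, Real.norm_eq_abs]
    exact mul_le_mul (hMn n (Finset.mem_range.1 hn).le) (norm_fourierChar_sub_succ_le n t)
      (norm_nonneg _) (by positivity)
  rw [Finset.sum_const, Finset.card_range, nsmul_eq_mul] at h2
  calc ‖(mertensFunction (N : ℝ) : ℂ) * (𝐞 ((N : ℝ) * t) : ℂ)‖ +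
        ‖∑ n ∈ Finset.range N, (mertensFunction (n : ℝ) : ℂ) *
          ((𝐞 ((n : ℝ) * t) : ℂ) - 𝐞 (((n : ℝ) + 1) * t))‖
      ≤ C * (N : ℝ) ^ a + N * (C * (N : ℝ) ^ a * (2 * π * |t|)) := add_le_add h1 h2
    _ = C * (N : ℝ) ^ a * (1 + 2 * π * N * |t|) := by ring

/-- **(i) ⟹ (ii) of Thm. 4.1**: under RH, for every `η > 0`, `q > 0` (in particular every finite
`q ≥ 1`) and `c > 0`, `M_{q,c}(N) = O(N^η)`: Littlewood's `|M(n)| ≤ C n^{1/2+η}` gives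
`|P_N(t)| ≤ C(1 + 2πc) N^η` on `|t| ≤ c/N`, hence the same bound for the local `L^q` mean.
[cite: Verjovsky2026, Thm. 4.1 ((i) ⟹ (ii)), §10 proof] -/
theorem moebiusLocalMoment_isBigO_of_riemannHypothesis (hRH : RiemannHypothesis) {η : ℝ}
    (hη : 0 < η) {q : ℝ} (hq : 0 < q) {c : ℝ} (hc : 0 < c) :
    (fun N : ℕ ↦ moebiusLocalMoment q c N) =O[atTop] fun N : ℕ ↦ (N : ℝ) ^ η := by
  obtain ⟨C, hC0, hC⟩ := MertensDictionary.exists_bound_of_isBigO (by positivity)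
    (mertensFunction_isBigO_of_riemannHypothesis hRH hη)
  refine IsBigO.of_bound (C * (1 + 2 * π * c)) ?_
  filter_upwards [eventually_ge_atTop 1] with N hN
  have hN0 : (0 : ℝ) < N := by exact_mod_cast hN
  have hsq : 0 < Real.sqrt N := Real.sqrt_pos.2 hN0
  rw [Real.norm_eq_abs, abs_of_nonneg (moebiusLocalMoment_nonneg hc.le N), Real.norm_eq_abs,
    abs_of_nonneg (rpow_nonneg hN0.le _)]
  have hsup : ∀ t ∈ Set.Icc (-(c / N)) (c / N),
      ‖moebiusFourierPoly N t / ((Real.sqrt N : ℝ) : ℂ)‖ ≤ C * (1 + 2 * π * c) * (N : ℝ) ^ η := by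
    intro t ht
    have ht' : |t| ≤ c / N := abs_le.2 ⟨ht.1, ht.2⟩
    have hNt : (N : ℝ) * |t| ≤ c := by
      calc (N : ℝ) * |t| ≤ N * (c / N) := by gcongr
        _ = c := by field_simp
    have hS := norm_moebiusFourierPoly_le hC0 (by positivity : (0 : ℝ) ≤ 1 / 2 + η) hC N t
    rw [norm_div, Complex.norm_real, Real.norm_eq_abs, abs_of_pos hsq, div_le_iff₀ hsq]
    have hpow : (N : ℝ) ^ (1 / 2 + η) = Real.sqrt N * (N : ℝ) ^ η := by
      rw [rpow_add hN0, Real.sqrt_eq_rpow]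
    calc ‖moebiusFourierPoly N t‖ ≤ C * (N : ℝ) ^ (1 / 2 + η) * (1 + 2 * π * N * |t|) := hS
      _ ≤ C * (N : ℝ) ^ (1 / 2 + η) * (1 + 2 * π * c) := by
          refine mul_le_mul_of_nonneg_left ?_ (by positivity)
          nlinarith [hNt, Real.pi_pos]
      _ = C * (1 + 2 * π * c) * (N : ℝ) ^ η * Real.sqrt N := by rw [hpow]; ring
  have hmean := localPowerMean_le_of_norm_le (div_pos hc hN0) hq hsup
  show localPowerMean (fun t ↦ moebiusFourierPoly N t / ((Real.sqrt N : ℝ) : ℂ)) q (c / N) ^ (1 / q)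
    ≤ C * (1 + 2 * π * c) * (N : ℝ) ^ η
  calc localPowerMean (fun t ↦ moebiusFourierPoly N t / ((Real.sqrt N : ℝ) : ℂ)) q (c / N) ^ (1 / q)
      ≤ ((C * (1 + 2 * π * c) * (N : ℝ) ^ η) ^ q) ^ (1 / q) :=
        rpow_le_rpow (localPowerMean_nonneg _ _ (by positivity)) hmean (by positivity)
    _ = C * (1 + 2 * π * c) * (N : ℝ) ^ η := by
        rw [← rpow_mul (by positivity), mul_one_div_cancel hq.ne', rpow_one]

/-! ## §5 "(iii) ⟹ (i)": from one large moment to Littlewood's converse -/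

/-- The quantitative Remark 9.4: if `M_{q,c}(N) ≤ K N^η` (`N ≥ 1`, `q, c > 0`, `K, η ≥ 0`) then
`|M(N)| ≤ (2K + (2^{q+2}πc)^{1/(q+1)} K^{q/(q+1)}) · N^{1/2 + 1/(2(q+1)) + η}` (both terms of
Cor. 9.3 majorised by the common exponent). RH-FREE. [cite: Verjovsky2026, Remark 9.4 and §10 ("The first term in (11) is O(N^{1/2+η}), while the second is O(N^{1/2+1/(2(q+1))+ηq/(q+1)})")] -/
theorem abs_mertensFunction_le_of_moment_le {q c K η : ℝ} (hq : 0 < q) (hc : 0 < c) (hK : 0 ≤ K)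
    (hη : 0 ≤ η) {N : ℕ} (hN : 1 ≤ N) (hM : moebiusLocalMoment q c N ≤ K * (N : ℝ) ^ η) :
    |(mertensFunction (N : ℝ) : ℝ)| ≤
      (2 * K + (2 ^ (q + 2) * π * c) ^ (1 / (q + 1)) * K ^ (q / (q + 1))) *
        (N : ℝ) ^ (1 / 2 + 1 / (2 * (q + 1)) + η) := by
  have hN1 : (1 : ℝ) ≤ N := by exact_mod_cast hN
  have hN0 : (0 : ℝ) < N := by linarith
  have hq1 : 0 < q + 1 := by linarith
  set M : ℝ := moebiusLocalMoment q c N with hMdef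
  have hM0 : 0 ≤ M := moebiusLocalMoment_nonneg hc.le N
  set e : ℝ := 1 / 2 + 1 / (2 * (q + 1)) + η with he
  set C₁ : ℝ := (2 ^ (q + 2) * π * c) ^ (1 / (q + 1)) with hC₁
  have hC₁0 : 0 ≤ C₁ := by positivity
  have hKq : 0 ≤ K ^ (q / (q + 1)) := by positivity
  have hNe : 0 ≤ (N : ℝ) ^ e := by positivity
  rcases Verjovsky2026_cor_9_3 hN hq hc with h1 | h2
  · -- first term: `2 √N M ≤ 2K N^{1/2+η} ≤ 2K N^e`
    have hle : 2 * Real.sqrt N * M ≤ 2 * K * (N : ℝ) ^ e := by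
      calc 2 * Real.sqrt N * M ≤ 2 * Real.sqrt N * (K * (N : ℝ) ^ η) := by gcongr
        _ = 2 * K * (N : ℝ) ^ (1 / 2 + η) := by
            rw [rpow_add hN0, Real.sqrt_eq_rpow]; ring
        _ ≤ 2 * K * (N : ℝ) ^ e := by
            refine mul_le_mul_of_nonneg_left (rpow_le_rpow_of_exponent_le hN1 ?_) (by positivity)
            rw [he]; linarith [show 0 ≤ 1 / (2 * (q + 1)) by positivity]
    calc |(mertensFunction (N : ℝ) : ℝ)| ≤ 2 * K * (N : ℝ) ^ e := h1.trans hle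
      _ ≤ (2 * K + C₁ * K ^ (q / (q + 1))) * (N : ℝ) ^ e := by nlinarith [mul_nonneg hC₁0 hKq]
  · -- second term
    have hMpow : M ^ (q / (q + 1)) ≤ K ^ (q / (q + 1)) * (N : ℝ) ^ (η * (q / (q + 1))) := by
      calc M ^ (q / (q + 1)) ≤ (K * (N : ℝ) ^ η) ^ (q / (q + 1)) :=
            rpow_le_rpow hM0 hM (by positivity)
        _ = K ^ (q / (q + 1)) * (N : ℝ) ^ (η * (q / (q + 1))) := by
            rw [mul_rpow hK (by positivity), ← rpow_mul hN0.le]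
    have hexp1 : (1 + q / 2) / (q + 1) = 1 / 2 + 1 / (2 * (q + 1)) := by
      field_simp; ring
    have hexp2 : (1 + q / 2) / (q + 1) + η * (q / (q + 1)) ≤ e := by
      rw [hexp1, he]
      have : η * (q / (q + 1)) ≤ η := by
        have hq' : q / (q + 1) ≤ 1 := by rw [div_le_one hq1]; linarith
        nlinarith
      linarith
    have hle : C₁ * (N : ℝ) ^ ((1 + q / 2) / (q + 1)) * M ^ (q / (q + 1)) ≤
        C₁ * K ^ (q / (q + 1)) * (N : ℝ) ^ e := by
      calc C₁ * (N : ℝ) ^ ((1 + q / 2) / (q + 1)) * M ^ (q / (q + 1))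
          ≤ C₁ * (N : ℝ) ^ ((1 + q / 2) / (q + 1)) * (K ^ (q / (q + 1)) * (N : ℝ) ^ (η * (q / (q + 1)))) := by
            gcongr
        _ = C₁ * K ^ (q / (q + 1)) * (N : ℝ) ^ ((1 + q / 2) / (q + 1) + η * (q / (q + 1))) := by
            rw [rpow_add hN0]; ring
        _ ≤ C₁ * K ^ (q / (q + 1)) * (N : ℝ) ^ e :=
            mul_le_mul_of_nonneg_left (rpow_le_rpow_of_exponent_le hN1 hexp2) (by positivity)
    calc |(mertensFunction (N : ℝ) : ℝ)| ≤ C₁ * K ^ (q / (q + 1)) * (N : ℝ) ^ e := h2.trans hle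
      _ ≤ (2 * K + C₁ * K ^ (q / (q + 1))) * (N : ℝ) ^ e := by nlinarith [mul_nonneg hK hNe]

/-- `M(x) = M(⌊x⌋)`. [folklore] -/
private theorem mertensFunction_eq_floor (x : ℝ) :
    mertensFunction x = mertensFunction (⌊x⌋₊ : ℝ) := by
  unfold mertensFunction
  rw [Nat.floor_natCast]

/-- **(iii) ⟹ (i) of Thm. 4.1**: if for every `η > 0` there is an unbounded `Q_η ⊆ [1,∞)` with
`M_{q,c}(N) = O(N^η)` for `q ∈ Q_η`, then RH: for `ε > 0` fix first `η = ε/3`, then `q ∈ Q_η`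
with `1/(2(q+1)) ≤ ε/3` (Remark 4.2 on the order of choices); Cor. 9.3 gives
`M(N) = O(N^{1/2+ε})`, and Littlewood's converse concludes.
[cite: Verjovsky2026, Thm. 4.1 ((iii) ⟹ (i)), §10 proof and Remark 4.2] -/
theorem riemannHypothesis_of_moebiusLocalMoment_isBigO {c : ℝ} (hc : 0 < c)
    (h : ∀ η : ℝ, 0 < η → ∃ Q : Set ℝ, Q ⊆ Set.Ici 1 ∧ ¬ BddAbove Q ∧
      ∀ q ∈ Q, (fun N : ℕ ↦ moebiusLocalMoment q c N) =O[atTop] fun N : ℕ ↦ (N : ℝ) ^ η) :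
    RiemannHypothesis := by
  refine riemannHypothesis_of_mertensFunction_isBigO fun ε hε ↦ ?_
  obtain ⟨Q, hQ1, hQub, hQ⟩ := h (ε / 3) (by positivity)
  obtain ⟨q, hqQ, hqbig⟩ := not_bddAbove_iff.1 hQub (3 / (2 * ε))
  have hq1 : (1 : ℝ) ≤ q := hQ1 hqQ
  have hq0 : 0 < q := by linarith
  have hexp : 1 / (2 * (q + 1)) ≤ ε / 3 := by
    have h3 : 3 < q * (2 * ε) := (div_lt_iff₀ (by positivity)).1 hqbig
    rw [div_le_div_iff₀ (by positivity) (by positivity)]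
    nlinarith
  obtain ⟨K, hK0, hKw⟩ := (hQ q hqQ).exists_nonneg
  obtain ⟨N₀, hN₀⟩ := eventually_atTop.1 hKw.bound
  set Ctot : ℝ := 2 * K + (2 ^ (q + 2) * π * c) ^ (1 / (q + 1)) * K ^ (q / (q + 1)) with hCtot
  have hCtot0 : 0 ≤ Ctot := by positivity
  -- the bound at integers `N ≥ max N₀ 1`
  have hnat : ∀ N : ℕ, N₀ ≤ N → 1 ≤ N →
      |(mertensFunction (N : ℝ) : ℝ)| ≤ Ctot * (N : ℝ) ^ (1 / 2 + ε) := by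
    intro N hNN hN1
    have hN1' : (1 : ℝ) ≤ N := by exact_mod_cast hN1
    have hb := hN₀ N hNN
    rw [Real.norm_eq_abs, abs_of_nonneg (moebiusLocalMoment_nonneg hc.le N), Real.norm_eq_abs,
      abs_of_nonneg (rpow_nonneg (by positivity) _)] at hb
    have h1 := abs_mertensFunction_le_of_moment_le hq0 hc hK0 (by positivity : (0 : ℝ) ≤ ε / 3)
      hN1 hb
    refine h1.trans (mul_le_mul_of_nonneg_left ?_ hCtot0)
    exact rpow_le_rpow_of_exponent_le hN1' (by linarith)
  refine IsBigO.of_bound Ctot ?_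
  filter_upwards [eventually_ge_atTop (max (N₀ : ℝ) 1)] with x hx
  have hx1 : 1 ≤ x := (le_max_right _ _).trans hx
  have hx0 : 0 ≤ x := by linarith
  have hxN : (N₀ : ℝ) ≤ x := (le_max_left _ _).trans hx
  have hfl : N₀ ≤ ⌊x⌋₊ := Nat.le_floor hxN
  have hfl1 : 1 ≤ ⌊x⌋₊ := Nat.le_floor (by simpa using hx1)
  rw [Real.norm_eq_abs, Real.norm_eq_abs, abs_of_nonneg (rpow_nonneg hx0 _),
    mertensFunction_eq_floor x]
  refine (hnat ⌊x⌋₊ hfl hfl1).trans (mul_le_mul_of_nonneg_left ?_ hCtot0)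
  exact rpow_le_rpow (Nat.cast_nonneg _) (Nat.floor_le hx0) (by positivity)

end MoebiusFourier

open MoebiusFourier

/-- **Verjovsky, Thm. 4.1 ((i) ⟺ (ii))** (local Fourier-moment criterion; `c > 0` fixed): RH holds
iff for every `η > 0` and every finite `q ≥ 1`, `M_{q,c}(N) = O_{η,q,c}(N^η)`. RH-EQUIVALENT.
[cite: Verjovsky2026, Thm. 4.1 ((i) ⟺ (ii))] -/
theorem Verjovsky2026_thm_4_1 {c : ℝ} (hc : 0 < c) :
    RiemannHypothesis ↔
      ∀ η : ℝ, 0 < η → ∀ q : ℝ, 1 ≤ q →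
        (fun N : ℕ ↦ moebiusLocalMoment q c N) =O[atTop] fun N : ℕ ↦ (N : ℝ) ^ η := by
  refine ⟨fun hRH η hη q hq ↦
    moebiusLocalMoment_isBigO_of_riemannHypothesis hRH hη (by linarith) hc, fun h ↦ ?_⟩
  refine riemannHypothesis_of_moebiusLocalMoment_isBigO hc fun η hη ↦ ?_
  exact ⟨Set.Ici 1, subset_rfl, not_bddAbove_Ici 1, fun q hq ↦ h η hη q hq⟩

/-- **Verjovsky, Thm. 4.1 ((i) ⟺ (iii))**: RH holds iff for every `η > 0` there is an unbounded
set `Q_η ⊆ [1, ∞)` such that `M_{q,c}(N) = O_{η,q,c}(N^η)` for every `q ∈ Q_η` (the set may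
depend on `η`, Remark 4.2). RH-EQUIVALENT. [cite: Verjovsky2026, Thm. 4.1 ((i) ⟺ (iii)), Remark 4.2] -/
theorem Verjovsky2026_thm_4_1_iii {c : ℝ} (hc : 0 < c) :
    RiemannHypothesis ↔
      ∀ η : ℝ, 0 < η → ∃ Q : Set ℝ, Q ⊆ Set.Ici 1 ∧ ¬ BddAbove Q ∧
        ∀ q ∈ Q, (fun N : ℕ ↦ moebiusLocalMoment q c N) =O[atTop] fun N : ℕ ↦ (N : ℝ) ^ η := by
  refine ⟨fun hRH η hη ↦ ?_, riemannHypothesis_of_moebiusLocalMoment_isBigO hc⟩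
  exact ⟨Set.Ici 1, subset_rfl, not_bddAbove_Ici 1, fun q hq ↦
    moebiusLocalMoment_isBigO_of_riemannHypothesis hRH hη (by linarith [Set.mem_Ici.1 hq]) hc⟩

end Literature.NumberTheory.LFunctions

end
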